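import Literature.MathematicalPhysics.QuantumLattice.Imbrie2016.DeepScaleLaw
import Literature.MathematicalPhysics.QuantumLattice.Imbrie2016.EigenvalueScaling
import Literature.MathematicalPhysics.QuantumLattice.Imbrie2016.ShiftedWindows

/-!
# Imbrie (2016): the exact longitudinal rescaling (h, Γ, J) ↦ (ηh, Γ, ηJ) — coupling γ ↦ γ/η — and the transfer of
# small-gap laws DOWN the coupling for uniform laws (kernel-checked)

CITATION HEADER (lean-in-tree rule 2026-08-18). J. Z. Imbrie, *On many-body localization for quantum spin chains*,
J. Stat. Phys. **163** (2016) 998–1048, doi 10.1007/s10955-016-1508-x, arXiv:1403.7837 [ImbrieJSP2016]: eq. (1.1) (the box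
Hamiltonian with + boundary condition, LINEAR in the couplings (h, J) and in γΓ), p. 1000 (laws with bounded densities on
[-1,1]; the uniform law is the model case), eq. (1.3) (Assumption LLA(ν, C)), eq. (5.3) (scaling of the spectrum).

WHAT IS PROVED (audit cell `pub-imbrie`, seat 1 gen 14, LLA.md WH6 (a); elementary, no statement of the paper is touched):
* `H_rescale` — H(γ; ηh, Γ, ηJ) = η · H(γ/η; h, Γ, J) (η ≠ 0): scaling the LONGITUDINAL couplings (fields AND bonds, boundary
  bonds included) by η is the same as multiplying the Hamiltonian at coupling γ/η by η; hence `eigs_rescale`,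
  `smallGap_rescale_iff` — SmallGap γ δ (ηh, Γ, ηJ) ↔ SmallGap (γ/η) (δ/η) (h, Γ, J) (η > 0).
* `unifLaw`, `Laws.unif` — the uniform law on [-1,1] at every site/bond (admissible with ρ₀ = 1/2: `unifLaw_admissible`);
  `pi_unifLaw`, `boxMeasure_unif` — its box law is (1/2)^{3n+1} · Lebesgue restricted to the cube.
* `det_rescaleLin` — the rescaling is linear with determinant η^{2n+1}; `boxMeasure_unif_rescale_le` — THE TRANSFER: for
  0 < η ≤ 1,  P_{γ/η}(min-gap < δ) ≤ η^{-(2n+1)} · P_γ(min-gap < ηδ)  (uniform laws, every box of n sites).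
* consequences: `lla_unif_rescale` — LLA(ν, C) at coupling γ ⟹ LLA(ν, C η^{-3}) at coupling γ/η (0 < η ≤ 1, ν ≥ 0, C ≥ 0);
  `ExpScaleGapLaw` (TYPED SHAPE (DEEP₁) of LLA.md WH6: P(min-gap < δ) ≤ δ^{ν₁} K^n for all 0 < δ ≤ c^n — hypothesis shape,
  never asserted) and `expScaleGapLaw_one_of_deepLLA_unif` — (DEEP)(ν₁, K, A, Θ₁) at coupling γ ∈ (0,1] for uniform laws
  ⟹ (DEEP₁) at coupling ONE with K₁ = K γ^{-(A+3)}, c₁ = γ^{Θ₁}: the γ-FREE NECESSARY FORM of the audit's residue.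
MEANING. Any small-gap hypothesis at small coupling γ contains, on the exact sub-family {|h|, |J| ≤ η}, the same hypothesis
for the chain at coupling γ/η up to the factor η^{-(2n+1)}; at η = γ the chain has all couplings of order one. Nothing here
is evidence for LLA or (DEEP); Theorem 1.1 of [ImbrieJSP2016] remains conditional. No `sorry`, no new axioms.
-/

noncomputable section

namespace Literature.MathematicalPhysics.QuantumLattice.Imbrie2016

open _root_.MeasureTheory Set
open SmallGapDictionary (Triple)

/-! ### The rescaling map and the Hamiltonian -/

/-- [cite: ImbrieJSP2016, eq. (1.1)] the longitudinal rescaling `(h, Γ, J) ↦ (ηh, Γ, ηJ)` as a linear endomorphism of the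
coupling space `Triple n = ℝⁿ × ℝⁿ × ℝⁿ⁺¹`. -/
def rescaleLin (n : ℕ) (η : ℝ) : Triple n →ₗ[ℝ] Triple n :=
  (η • LinearMap.id).prodMap (LinearMap.id.prodMap (η • LinearMap.id))

/-- [cite: ImbrieJSP2016, eq. (1.1)] pointwise form of `rescaleLin`. -/
@[simp] theorem rescaleLin_apply (n : ℕ) (η : ℝ) (t : Triple n) :
    rescaleLin n η t = (η • t.1, t.2.1, η • t.2.2) := by
  rfl

/-- [cite: ImbrieJSP2016, eq. (1.1)] `det (rescaleLin n η) = η^{2n+1}` (n fields and n+1 bonds are scaled). -/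
theorem det_rescaleLin (n : ℕ) (η : ℝ) : LinearMap.det (rescaleLin n η) = η ^ (2 * n + 1) := by
  rw [rescaleLin, LinearMap.det_prodMap, LinearMap.det_prodMap, LinearMap.det_smul, LinearMap.det_smul,
    Module.finrank_fintype_fun_eq_card, Module.finrank_fintype_fun_eq_card, Fintype.card_fin, Fintype.card_fin]
  simp only [LinearMap.det_id, mul_one, one_mul]
  ring

/-- [cite: ImbrieJSP2016, eq. (1.1)] the diagonal (Ising + field, + boundary condition) energy is homogeneous of degree
one in (h, J) and does not see Γ. -/
theorem diagEnergy_rescale {n : ℕ} (η : ℝ) (t : Triple n) (σ : Cfg n) :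
    diagEnergy (Params.ofTriple (rescaleLin n η t)) σ = η * diagEnergy (Params.ofTriple t) σ := by
  rw [rescaleLin_apply]
  unfold diagEnergy Params.ofTriple
  simp only [Pi.smul_apply, smul_eq_mul]
  rw [mul_add, Finset.mul_sum, Finset.mul_sum]
  congr 1 <;> exact Finset.sum_congr rfl fun _ _ => by ring

/-- [cite: ImbrieJSP2016, eq. (1.1)] the transverse part does not see (h, J): `γΓ_i = η · ((γ/η) Γ_i)`. -/
theorem offDiag_rescale {n : ℕ} (γ η : ℝ) (hη : η ≠ 0) (t : Triple n) (σ τ : Cfg n) :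
    offDiag γ (Params.ofTriple (rescaleLin n η t)) σ τ = η * offDiag (γ / η) (Params.ofTriple t) σ τ := by
  rw [rescaleLin_apply]
  unfold offDiag Params.ofTriple
  simp only
  rw [Finset.mul_sum]
  refine Finset.sum_congr rfl fun i _ => ?_
  split_ifs
  · field_simp
  · simp

/-- [cite: ImbrieJSP2016, eq. (1.1)] **H(γ; ηh, Γ, ηJ) = η · H(γ/η; h, Γ, J)** for `η ≠ 0`. -/
theorem H_rescale {n : ℕ} (γ η : ℝ) (hη : η ≠ 0) (t : Triple n) :
    H γ (Params.ofTriple (rescaleLin n η t)) = η • H (γ / η) (Params.ofTriple t) := by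
  ext σ τ
  simp only [H, Matrix.add_apply, Matrix.diagonal_apply, Matrix.of_apply, Matrix.smul_apply, smul_eq_mul,
    diagEnergy_rescale, offDiag_rescale γ η hη]
  split_ifs <;> ring

/-- [cite: ImbrieJSP2016, eq. (1.1) and (5.3)] the ordered spectra: `eigs γ (ηh, Γ, ηJ) = η · eigs (γ/η) (h, Γ, J)` (η > 0). -/
theorem eigs_rescale {n : ℕ} (γ η : ℝ) (hη : 0 < η) (t : Triple n) :
    eigs γ (Params.ofTriple (rescaleLin n η t)) = η • eigs (γ / η) (Params.ofTriple t) := by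
  have key : ∀ (B : Matrix (Cfg n) (Cfg n) ℝ) (hB : B.IsHermitian), B = η • H (γ / η) (Params.ofTriple t) →
      hB.eigenvalues = η • (H_isHermitian (γ / η) (Params.ofTriple t)).eigenvalues := by
    rintro B hB rfl
    exact EigenvalueScaling.eigenvalues_smul_real (H_isHermitian (γ / η) (Params.ofTriple t)) hη.le
  exact key _ (H_isHermitian γ _) (H_rescale γ η hη.ne' t)

/-- [cite: ImbrieJSP2016, eq. (1.3) with (5.3)] **the small-gap event transfers exactly**:
`SmallGap γ δ (ηh, Γ, ηJ) ↔ SmallGap (γ/η) (δ/η) (h, Γ, J)` for `η > 0`. -/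
theorem smallGap_rescale_iff {n : ℕ} (γ δ η : ℝ) (hη : 0 < η) (t : Triple n) :
    SmallGap γ δ (Params.ofTriple (rescaleLin n η t)) ↔ SmallGap (γ / η) (δ / η) (Params.ofTriple t) := by
  unfold SmallGap
  rw [eigs_rescale γ η hη t]
  simp only [Pi.smul_apply, smul_eq_mul, ← mul_sub, abs_mul, abs_of_pos hη]
  constructor
  · rintro ⟨α, β, hαβ, hlt⟩
    exact ⟨α, β, hαβ, by
      rw [lt_div_iff₀ hη]
      linarith [mul_comm η (|eigs (γ / η) (Params.ofTriple t) α - eigs (γ / η) (Params.ofTriple t) β|)]⟩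
  · rintro ⟨α, β, hαβ, hlt⟩
    exact ⟨α, β, hαβ, by
      rw [lt_div_iff₀ hη] at hlt
      linarith [mul_comm η (|eigs (γ / η) (Params.ofTriple t) α - eigs (γ / η) (Params.ofTriple t) β|)]⟩

/-! ### Uniform laws -/

/-- [cite: ImbrieJSP2016, p. 1000] the uniform law on [-1,1] (density 1/2). -/
def unifLaw : Measure ℝ := ENNReal.ofReal (1 / 2 : ℝ) • (volume : Measure ℝ).restrict (Set.Icc (-1 : ℝ) 1)

/-- [cite: ImbrieJSP2016, p. 1000] uniform laws at every site and bond. -/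
def Laws.unif : Laws := ⟨fun _ => unifLaw, fun _ => unifLaw, fun _ => unifLaw⟩

/-- [cite: ImbrieJSP2016, p. 1000] the uniform law is a probability measure. -/
instance unifLaw_isProbabilityMeasure : IsProbabilityMeasure unifLaw := by
  constructor
  simp only [unifLaw, Measure.smul_apply, Measure.restrict_apply MeasurableSet.univ, Set.univ_inter, Real.volume_Icc,
    smul_eq_mul]
  rw [← ENNReal.ofReal_mul (by norm_num)]
  norm_num

/-- [cite: ImbrieJSP2016, p. 1000] the uniform law is admissible with density bound ρ₀ = 1/2. -/
theorem unifLaw_admissible : Admissible (1 / 2) unifLaw :=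
  ⟨unifLaw_isProbabilityMeasure, le_rfl⟩

/-- [cite: ImbrieJSP2016, p. 1000] `Laws.unif` is admissible with ρ₀ = 1/2. -/
theorem Laws.unif_admissible : Laws.unif.Admissible (1 / 2) :=
  fun _ => ⟨unifLaw_admissible, unifLaw_admissible, unifLaw_admissible⟩

/-- [folklore] a probability measure is σ-finite (recorded as an instance for `Measure.pi_eq`). -/
instance unifLaw_sigmaFinite : SigmaFinite unifLaw := by
  infer_instance

/-- the coordinate cube `[-1,1]^m`. [folklore] -/
def coordCube (m : ℕ) : Set (Fin m → ℝ) := Set.univ.pi fun _ : Fin m => Set.Icc (-1 : ℝ) 1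

/-- [folklore] the coordinate cube is measurable. -/
theorem measurableSet_coordCube (m : ℕ) : MeasurableSet (coordCube m) :=
  MeasurableSet.univ_pi fun _ => measurableSet_Icc

/-- [cite: ImbrieJSP2016, p. 1000] the m-fold product of uniform laws is `(1/2)^m ·` Lebesgue restricted to `[-1,1]^m`. -/
theorem pi_unifLaw (m : ℕ) :
    Measure.pi (fun _ : Fin m => unifLaw) =
      ENNReal.ofReal ((1 / 2 : ℝ) ^ m) • (volume : Measure (Fin m → ℝ)).restrict (coordCube m) := by
  apply Measure.pi_eq
  intro s hs
  rw [Measure.smul_apply, coordCube, Measure.restrict_apply (MeasurableSet.univ_pi hs), ← Set.pi_inter_distrib,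
    volume_pi_pi, smul_eq_mul]
  simp only [unifLaw, Measure.smul_apply, Measure.restrict_apply (hs _), smul_eq_mul]
  rw [Finset.prod_mul_distrib, Finset.prod_const, Finset.card_univ, Fintype.card_fin,
    ENNReal.ofReal_pow (by norm_num)]

/-- [cite: ImbrieJSP2016, p. 1000] the coupling cube `ShiftedWindows.cube n = [-1,1]^n × [-1,1]^n × [-1,1]^{n+1}` is
`coordCube n ×ˢ (coordCube n ×ˢ coordCube (n+1))` (definitionally). -/
theorem cube_eq_prod_coordCube (n : ℕ) : cube n = coordCube n ×ˢ (coordCube n ×ˢ coordCube (n + 1)) := rfl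

/-- [cite: ImbrieJSP2016, p. 1000 and eq. (1.1)] the box law of `Laws.unif` is `(1/2)^{3n+1} ·` Lebesgue restricted to the
cube of the coupling space (every position `a`). -/
theorem boxMeasure_unif (a : ℤ) (n : ℕ) :
    Laws.unif.boxMeasure a n =
      ENNReal.ofReal ((1 / 2 : ℝ) ^ (3 * n + 1)) • (volume : Measure (Triple n)).restrict (cube n) := by
  unfold Laws.boxMeasure
  simp only [Laws.unif]
  rw [pi_unifLaw n, pi_unifLaw (n + 1), Measure.prod_smul_left, Measure.prod_smul_left, Measure.prod_smul_right,
    Measure.prod_smul_right, Measure.prod_smul_right, Measure.prod_restrict, Measure.prod_restrict,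
    cube_eq_prod_coordCube, Measure.volume_eq_prod, Measure.volume_eq_prod, smul_smul, smul_smul,
    ← ENNReal.ofReal_mul (by positivity), ← ENNReal.ofReal_mul (by positivity), ← pow_add, ← pow_add]
  congr 2
  ring

/-! ### The transfer down the coupling -/

/-- [folklore] Lebesgue measure on the coupling space `ℝⁿ × ℝⁿ × ℝⁿ⁺¹` is an additive Haar measure (product of Haar
measures; recorded explicitly because instance search does not unfold the product `volume`). -/
instance volume_triple_isAddHaar (n : ℕ) : (volume : Measure (Triple n)).IsAddHaarMeasure := by
  haveI : ((volume : Measure (Fin n → ℝ)).prod (volume : Measure (Fin (n + 1) → ℝ))).IsAddHaarMeasure :=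
    Measure.prod.instIsAddHaarMeasure _ _
  exact Measure.prod.instIsAddHaarMeasure (volume : Measure (Fin n → ℝ))
    ((volume : Measure (Fin n → ℝ)).prod (volume : Measure (Fin (n + 1) → ℝ)))

/-- [cite: ImbrieJSP2016, eq. (1.3), p. 1000] **TRANSFER OF SMALL-GAP LAWS DOWN THE COUPLING (uniform laws).** For
`0 < η ≤ 1`, every box of `n` sites, every `γ`, `δ`:
`P_{γ/η}(min-gap < δ) ≤ η^{-(2n+1)} · P_γ(min-gap < ηδ)`.
Proof: the small-gap event at coupling γ/η inside the cube is carried by `(h,Γ,J) ↦ (ηh, Γ, ηJ)` (determinant η^{2n+1},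
cube to cube since η ≤ 1) into the small-gap event at coupling γ and threshold ηδ (`smallGap_rescale_iff`). -/
theorem boxMeasure_unif_rescale_le (a : ℤ) (n : ℕ) (γ δ η : ℝ) (hη : 0 < η) (hη1 : η ≤ 1) :
    Laws.unif.boxMeasure a n {t | SmallGap (γ / η) δ (Params.ofTriple t)} ≤
      ENNReal.ofReal ((η ^ (2 * n + 1))⁻¹) *
        Laws.unif.boxMeasure a n {t | SmallGap γ (η * δ) (Params.ofTriple t)} := by
  rw [boxMeasure_unif]
  simp only [Measure.smul_apply, smul_eq_mul]
  have hmc : MeasurableSet (cube n) := by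
    rw [cube_eq_prod_coordCube]
    exact (measurableSet_coordCube n).prod ((measurableSet_coordCube n).prod (measurableSet_coordCube (n + 1)))
  rw [Measure.restrict_apply' hmc, Measure.restrict_apply' hmc]
  have hsub : {t : Triple n | SmallGap (γ / η) δ (Params.ofTriple t)} ∩ cube n ⊆
      rescaleLin n η ⁻¹' ({t : Triple n | SmallGap γ (η * δ) (Params.ofTriple t)} ∩ cube n) := by
    rintro t ⟨ht, hc⟩
    refine ⟨?_, ?_⟩
    · show SmallGap γ (η * δ) (Params.ofTriple (rescaleLin n η t))
      rw [smallGap_rescale_iff γ (η * δ) η hη t, mul_div_cancel_left₀ δ hη.ne']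
      exact ht
    · simp only [cube_eq_prod_coordCube, coordCube, rescaleLin_apply, Set.mem_prod, Set.mem_univ_pi,
        Pi.smul_apply, smul_eq_mul] at hc ⊢
      exact ⟨fun i => mul_mem_Icc_of_mem_Icc (hc.1 i) hη.le hη1, hc.2.1,
        fun i => mul_mem_Icc_of_mem_Icc (hc.2.2 i) hη.le hη1⟩
  have hdet : LinearMap.det (rescaleLin n η) ≠ 0 := by
    rw [det_rescaleLin]; positivity
  have hvol := Measure.addHaar_preimage_linearMap (volume : Measure (Triple n)) hdet
    ({t : Triple n | SmallGap γ (η * δ) (Params.ofTriple t)} ∩ cube n)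
  rw [det_rescaleLin, abs_of_pos (by positivity)] at hvol
  calc ENNReal.ofReal ((1 / 2 : ℝ) ^ (3 * n + 1)) *
        volume ({t : Triple n | SmallGap (γ / η) δ (Params.ofTriple t)} ∩ cube n)
      ≤ ENNReal.ofReal ((1 / 2 : ℝ) ^ (3 * n + 1)) *
        volume (rescaleLin n η ⁻¹' ({t : Triple n | SmallGap γ (η * δ) (Params.ofTriple t)} ∩ cube n)) := by
        gcongr
    _ = ENNReal.ofReal ((η ^ (2 * n + 1))⁻¹) * (ENNReal.ofReal ((1 / 2 : ℝ) ^ (3 * n + 1)) *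
        volume ({t : Triple n | SmallGap γ (η * δ) (Params.ofTriple t)} ∩ cube n)) := by
        rw [hvol, mul_left_comm]

/-- [cite: ImbrieJSP2016, eq. (1.3)] **LLA transfers down the coupling**: for uniform laws, `LLA(ν, C)` at coupling `γ`
implies `LLA(ν, C η^{-3})` at coupling `γ/η` (0 < η ≤ 1, ν ≥ 0, C ≥ 0).  (At η = γ: LLA at coupling ONE with constant Cγ^{-3}.)
Hypothesis-to-hypothesis; neither side is asserted. -/
theorem lla_unif_rescale {γ ν C η : ℝ} (hη : 0 < η) (hη1 : η ≤ 1) (hν : 0 ≤ ν) (hC : 0 ≤ C)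
    (h : LLA Laws.unif γ ν C) : LLA Laws.unif (γ / η) ν (C * η⁻¹ ^ 3) := by
  intro a n hn δ hδ
  refine (boxMeasure_unif_rescale_le a n γ δ η hη hη1).trans ?_
  have h1 := h a n hn (η * δ) (by positivity)
  refine (mul_le_mul' le_rfl h1).trans ?_
  rw [← ENNReal.ofReal_mul (by positivity)]
  apply ENNReal.ofReal_le_ofReal
  rw [Real.mul_rpow hη.le hδ.le, mul_pow]
  -- (η^(2n+1))⁻¹ * (η^ν δ^ν C^n) ≤ δ^ν (C^n (η⁻¹)^(3n))
  have key : (η ^ (2 * n + 1))⁻¹ * η ^ ν ≤ η⁻¹ ^ (3 * n) := by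
    rw [← Real.rpow_natCast η (2 * n + 1), ← Real.rpow_neg hη.le, inv_pow, ← Real.rpow_natCast η (3 * n),
      ← Real.rpow_neg hη.le, ← Real.rpow_add hη]
    apply Real.rpow_le_rpow_of_exponent_ge hη hη1
    have : (1 : ℝ) ≤ n := by exact_mod_cast hn
    push_cast
    linarith
  have hX : 0 ≤ δ ^ ν * C ^ n := by positivity
  calc (η ^ (2 * n + 1))⁻¹ * (η ^ ν * δ ^ ν * C ^ n) = ((η ^ (2 * n + 1))⁻¹ * η ^ ν) * (δ ^ ν * C ^ n) := by ring
    _ ≤ η⁻¹ ^ (3 * n) * (δ ^ ν * C ^ n) := mul_le_mul_of_nonneg_right key hX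
    _ = δ ^ ν * (C ^ n * (η⁻¹ ^ 3) ^ n) := by rw [← pow_mul]; ring

/-- **(DEEP₁) — small-gap law at exponentially small scales** (audit shape, LLA.md WH6; TYPED, never asserted): for every box
of n ≥ 1 sites and every `0 < δ ≤ c^n`, `P(min-gap < δ) ≤ δ^{ν₁} K^n`. [cite: ImbrieJSP2016, eq. (1.3)] -/
def ExpScaleGapLaw (L : Laws) (γ ν₁ K c : ℝ) : Prop :=
  ∀ (a : ℤ) (n : ℕ), 0 < n → ∀ δ : ℝ, 0 < δ → δ ≤ c ^ n →
    L.boxMeasure a n {t | SmallGap γ δ (Params.ofTriple t)} ≤ ENNReal.ofReal (δ ^ ν₁ * K ^ n)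

/-- [cite: ImbrieJSP2016, eq. (1.3)] **the γ-free necessary form** (LLA.md WH6 (a)): for uniform laws and `0 < γ ≤ 1`,
`(DEEP)(ν₁, K, A, Θ₁)` at coupling `γ` (ν₁ ≥ 0, K ≥ 0) implies `(DEEP₁)` at coupling ONE with `K₁ = K γ^{-(A+3)}` and
`c₁ = γ^{Θ₁}`:  P₁(min-gap < δ) ≤ δ^{ν₁} (Kγ^{-(A+3)})^n for all 0 < δ ≤ (γ^{Θ₁})^n.  Hypothesis-to-hypothesis only. -/
theorem expScaleGapLaw_one_of_deepLLA_unif {γ ν₁ K A Θ₁ : ℝ} (hγ : 0 < γ) (hγ1 : γ ≤ 1) (hν : 0 ≤ ν₁) (hK : 0 ≤ K)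
    (h : DeepLLA Laws.unif γ ν₁ K A Θ₁) :
    ExpScaleGapLaw Laws.unif 1 ν₁ (K * γ ^ (-(A + 3))) (γ ^ Θ₁) := by
  intro a n hn δ hδ hδc
  have ht := boxMeasure_unif_rescale_le a n γ δ γ hγ hγ1
  rw [div_self hγ.ne'] at ht
  refine ht.trans ?_
  have hdepth : γ * δ ≤ γ ^ (Θ₁ * n) := by
    calc γ * δ ≤ δ := mul_le_of_le_one_left hδ.le hγ1
      _ ≤ (γ ^ Θ₁) ^ n := hδc
      _ = γ ^ (Θ₁ * n) := by rw [← Real.rpow_natCast, ← Real.rpow_mul hγ.le]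
  have h1 := h a n hn (γ * δ) (by positivity) hdepth
  refine (mul_le_mul' le_rfl h1).trans ?_
  have hKA : 0 ≤ K * γ ^ (-A) := mul_nonneg hK (Real.rpow_nonneg hγ.le _)
  rw [← ENNReal.ofReal_mul (by positivity)]
  apply ENNReal.ofReal_le_ofReal
  rw [Real.mul_rpow hγ.le hδ.le]
  have key : (γ ^ (2 * n + 1))⁻¹ * γ ^ ν₁ ≤ (γ ^ (-(3 : ℝ))) ^ n := by
    rw [← Real.rpow_natCast γ (2 * n + 1), ← Real.rpow_neg hγ.le, ← Real.rpow_natCast (γ ^ (-(3 : ℝ))) n,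
      ← Real.rpow_mul hγ.le, ← Real.rpow_add hγ]
    apply Real.rpow_le_rpow_of_exponent_ge hγ hγ1
    have : (1 : ℝ) ≤ n := by exact_mod_cast hn
    push_cast
    linarith
  have e : (K * γ ^ (-(A + 3))) ^ n = (K * γ ^ (-A)) ^ n * (γ ^ (-(3 : ℝ))) ^ n := by
    rw [← mul_pow, mul_assoc, ← Real.rpow_add hγ]
    congr 2; ring
  have hX : 0 ≤ δ ^ ν₁ * (K * γ ^ (-A)) ^ n := by positivity
  calc (γ ^ (2 * n + 1))⁻¹ * (γ ^ ν₁ * δ ^ ν₁ * (K * γ ^ (-A)) ^ n)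
      = ((γ ^ (2 * n + 1))⁻¹ * γ ^ ν₁) * (δ ^ ν₁ * (K * γ ^ (-A)) ^ n) := by ring
    _ ≤ (γ ^ (-(3 : ℝ))) ^ n * (δ ^ ν₁ * (K * γ ^ (-A)) ^ n) := mul_le_mul_of_nonneg_right key hX
    _ = δ ^ ν₁ * (K * γ ^ (-(A + 3))) ^ n := by rw [e]; ring

end Literature.MathematicalPhysics.QuantumLattice.Imbrie2016
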